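import Summits.Parity.GeneralizedHardyLittlewood.Theorems.GreenTaoLevelTwoGITwoCyclicInverseLocalLinearPhase

/-!
# Route `GreenTaoLevelTwo`, crux `GITwo` (stmt-Parity-21275), line `birth`, stub `stub_cyclicInverse`:
# large `U³` norm ⇒ correlation with a locally linear family of frequencies (GT08a arXiv Prop. 45)

Thirty-sixth helper file toward the XL stub `stub_cyclicInverse` (B. Green, T. Tao, *An inverse
theorem for the Gowers `U³(G)` norm*, arXiv:math/0503014, Thm. 68 = PEMS 51 (2008) Thm. 12.8).
Block C10, arXiv Prop. 45 = Prop. 43 (`exists_locally_linear_phase`) combined with the large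
derivative Fourier coefficients of arXiv Prop. 24 (carried as `|(Δ_t f)^(ξ_t)|² ≥ ε/2` on `H''`):
the derivative `Δ_{x₀+h} f` correlates with the frequency `ξ₀ + μ h` ON AVERAGE over the regular
Bohr set `B₁`:
`Σ_{h∈B₁} |(Δ_{x₀+h} f)^(ξ₀ + μh)| ≥ (ε¹⁷/(2²³·128^d)) · (ε/2)^{1/2} · #B₁`
(qualitative form of the printed `𝔼_{h∈B₁} |𝔼_x T^{x₀+h}f · f̄ · e(−(ξ₀+2Mh)·x)| ≥ 2^{-C₄}η^{C'₄}`).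

* `sum_norm_dftCoeff_deriv_ge` — the averaging step (abstract: affine identity on `A ⊆ B₁` +
  termwise bound ⇒ sum bound);
* `exists_locally_linear_correlation` — **arXiv Prop. 45** (data of Prop. 43 + the averaged
  correlation bound).

References: [GreenTao2008U3Inverse] arXiv:math/0503014, Prop. 45 (from Props. 43 and 24).
-/

noncomputable section

namespace Summit.Parity.GeneralizedHardyLittlewood.GreenTaoLevelTwoGITwoCyclicInverse

open Finset

open Literature.NumberTheory.Sieve

variable {M : ℕ} [NeZero M]

omit [NeZero M] in
/-- The averaging step of arXiv Prop. 45: if `g(h) ≥ s` on `A = {h ∈ B₁ : P h}` and `g ≥ 0` then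
`Σ_{h∈B₁} g(h) ≥ s · #A`. [folklore] -/
theorem sum_ge_of_ge_on_filter (B₁ : Finset (ZMod M)) (P : ZMod M → Prop) [DecidablePred P]
    (g : ZMod M → ℝ) (hg0 : ∀ h, 0 ≤ g h) {s : ℝ} (hs : ∀ h ∈ B₁, P h → s ≤ g h) :
    s * #(B₁.filter P) ≤ ∑ h ∈ B₁, g h := by
  calc s * #(B₁.filter P) = ∑ h ∈ B₁.filter P, s := by rw [sum_const, nsmul_eq_mul, mul_comm]
    _ ≤ ∑ h ∈ B₁.filter P, g h := sum_le_sum fun h hh => by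
        rw [mem_filter] at hh; exact hs h hh.1 hh.2
    _ ≤ ∑ h ∈ B₁, g h := sum_le_sum_of_subset_of_nonneg (filter_subset _ _) fun h _ _ => hg0 h

/-- **GT08a arXiv Prop. 45 (qualitative): large `U³` norm gives correlation of the derivatives with a
locally linear family of frequencies, on average over a regular Bohr set.**  For `M` prime,
`|f| ≤ 1`, `‖f‖_{U³}^8 ≥ ε > 0`: the data of `exists_locally_linear_phase` (arXiv Prop. 43) and
`Σ_{h∈B₁} |(Δ_{x₀+h} f)^(ξ₀ + μ h)| ≥ (ε¹⁷/(2²³·128^d))·√(ε/2)·#B₁`, `B₁ = B(Spec,ρ)`.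
[cite: GreenTao2008U3Inverse, Prop. 45] -/
theorem exists_locally_linear_correlation (hM : M.Prime) {f : ZMod M → ℝ} (hf : ∀ x, |f x| ≤ 1)
    {ε : ℝ} (hε0 : 0 < ε) (hε : ε ≤ gowersPower 3 f) :
    ∃ (H'' Spec : Finset (ZMod M)) (μ : ZMod M → ZMod M) (d : ℕ) (ρ : ℝ) (x₀ ξ₀ : ZMod M),
      (d : ℝ) ≤ (2 ^ 225 / ε ^ 168) ^ 17 ∧
      ε ^ 17 / 2 ^ 23 * M / (128 : ℝ) ^ d ≤ #H'' ∧
      (#Spec : ℝ) * (((#H'' : ℝ) / M) ^ 3 / 4) ≤ (#H'' : ℝ) / M ∧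
      1 / 16 ≤ ρ ∧ ρ ≤ 1 / 8 ∧
      (∀ κ : ℝ, |κ| ≤ 1 / (100 * (#Spec : ℝ)) →
        (1 - 100 * (#Spec : ℝ) * |κ|) *
              #{x : ZMod M | ∀ ξ' ∈ Spec, ‖ZMod.toAddCircle (x * ξ')‖ < ρ} ≤
            #{x : ZMod M | ∀ ξ' ∈ Spec, ‖ZMod.toAddCircle (x * ξ')‖ < (1 + κ) * ρ} ∧
          (#{x : ZMod M | ∀ ξ' ∈ Spec, ‖ZMod.toAddCircle (x * ξ')‖ < (1 + κ) * ρ} : ℝ) ≤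
            (1 + 100 * (#Spec : ℝ) * |κ|) *
              #{x : ZMod M | ∀ ξ' ∈ Spec, ‖ZMod.toAddCircle (x * ξ')‖ < ρ}) ∧
      (∀ h₁ h₂ : ZMod M, (∀ ξ' ∈ Spec, ‖ZMod.toAddCircle (h₁ * ξ')‖ ≤ 1 / 4) →
        (∀ ξ' ∈ Spec, ‖ZMod.toAddCircle (h₂ * ξ')‖ ≤ 1 / 4) →
        (∀ ξ' ∈ Spec, ‖ZMod.toAddCircle ((h₁ + h₂) * ξ')‖ ≤ 1 / 4) →
        μ (h₁ + h₂) = μ h₁ + μ h₂) ∧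
      ε ^ 17 / 2 ^ 23 / (128 : ℝ) ^ d * Real.sqrt (ε / 2) *
          #{x : ZMod M | ∀ ξ' ∈ Spec, ‖ZMod.toAddCircle (x * ξ')‖ < ρ} ≤
        ∑ h ∈ ({x : ZMod M | ∀ ξ' ∈ Spec, ‖ZMod.toAddCircle (x * ξ')‖ < ρ} : Finset (ZMod M)),
          ‖dftCoeff (fun y => f y * f (y + (x₀ + h))) (ξ₀ + μ h)‖ := by
  classical
  have hMpos : (0 : ℝ) < M := by exact_mod_cast Nat.pos_of_ne_zero (NeZero.ne M)
  obtain ⟨H'', Spec, ξ, μ, d, ρ, x₀, ξ₀, hd, hfreq, hcard, hSpec, hρ1, hρ2, hreg, hadd, hA, haff⟩ :=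
    exists_locally_linear_phase hM hf hε0 hε
  refine ⟨H'', Spec, μ, d, ρ, x₀, ξ₀, hd, hcard, hSpec, hρ1, hρ2, hreg, hadd, ?_⟩
  set B₁ : Finset (ZMod M) := {x : ZMod M | ∀ ξ' ∈ Spec, ‖ZMod.toAddCircle (x * ξ')‖ < ρ}
    with hB₁
  -- termwise: on `A`, `ξ₀ + μ h = ξ(x₀+h)` and `|(Δ_{x₀+h}f)^(ξ(x₀+h))| ≥ √(ε/2)`
  have hterm : ∀ h ∈ B₁, x₀ + h ∈ H'' →
      Real.sqrt (ε / 2) ≤ ‖dftCoeff (fun y => f y * f (y + (x₀ + h))) (ξ₀ + μ h)‖ := by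
    intro h hh hxh
    rw [← haff h hh hxh]
    have h1 := hfreq (x₀ + h) hxh
    exact (Real.sqrt_le_sqrt h1).trans_eq (Real.sqrt_sq (norm_nonneg _))
  have hsum := sum_ge_of_ge_on_filter B₁ (fun h => x₀ + h ∈ H'')
    (fun h => ‖dftCoeff (fun y => f y * f (y + (x₀ + h))) (ξ₀ + μ h)‖) (fun _ => norm_nonneg _)
    hterm
  -- `#A ≥ #B₁ #H''/M ≥ #B₁ ε¹⁷/(2²³ 128^d)`
  have hA' : ε ^ 17 / 2 ^ 23 / (128 : ℝ) ^ d * #B₁ ≤ #(B₁.filter fun h => x₀ + h ∈ H'') := by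
    refine le_trans ?_ hA
    rw [mul_div_assoc]
    have h1 : ε ^ 17 / 2 ^ 23 / (128 : ℝ) ^ d ≤ (#H'' : ℝ) / M := by
      rw [le_div_iff₀ hMpos]
      have h2 : ε ^ 17 / 2 ^ 23 / (128 : ℝ) ^ d * (M : ℝ) = ε ^ 17 / 2 ^ 23 * M / (128 : ℝ) ^ d := by
        ring
      rw [h2]; exact hcard
    calc ε ^ 17 / 2 ^ 23 / (128 : ℝ) ^ d * #B₁ ≤ (#H'' : ℝ) / M * #B₁ :=
          mul_le_mul_of_nonneg_right h1 (Nat.cast_nonneg _)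
      _ = #B₁ * (#H'' / M) := by ring
  calc ε ^ 17 / 2 ^ 23 / (128 : ℝ) ^ d * Real.sqrt (ε / 2) * #B₁
      = Real.sqrt (ε / 2) * (ε ^ 17 / 2 ^ 23 / (128 : ℝ) ^ d * #B₁) := by ring
    _ ≤ Real.sqrt (ε / 2) * #(B₁.filter fun h => x₀ + h ∈ H'') :=
        mul_le_mul_of_nonneg_left hA' (Real.sqrt_nonneg _)
    _ ≤ _ := hsum

end Summit.Parity.GeneralizedHardyLittlewood.GreenTaoLevelTwoGITwoCyclicInverse
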